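/-
Copyright (c) 2026 the pub-hodgecm-mathlib formalisation cell (harness21).  Prover seat hodgecm-mathlib-LH4-p07 (g6), req620 Track A «(D-RAM) FOUR-FRAME» squad
(unit U2H_HSide, the (ρ2b′-X) road :418; payer by lineage LH4-p14 (g4) 2026-09-04T04:44Z «(γ) O-Glue COUNT organ, take it by name»; dealer LH4-plan (g12) WORD #21∕#22).
File 1∕2 of the organ: the T2-side PLANE GLUE DATA and the fixed criterion in plane letters.  2026-09-04.
-/
import Literature.NumberTheory.Automorphic.UnitaryLatticeTreeBlockGlueFixed         -- ★ T2c p857252 (LH4-p05 (g4)): fixed criterion in a fibre, plane bridge `ι_W`; brings ★ T2a p857187 glue data, ★ TubeCoordinate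
import Literature.NumberTheory.Automorphic.UnitaryLatticeTreeTubeAxisVertex          -- ★ p848332: `v_pairing_generator_proj`, `exists_axisVertex_eq_latt_endoGL`, `mem_kerProj_one_iff`
import Literature.NumberTheory.Automorphic.UnitaryLatticeTreeAxisEndoFrame           -- ★ (z1-b): `coe_endoGL_eq_endoShape`, `det_endoShape`
import Literature.NumberTheory.Automorphic.UnitaryLatticeTreeFramed                  -- ★ `exists_eq_latt_of_latt_le_of_le_latt` (PID sandwich)
import Literature.NumberTheory.Automorphic.UnitaryLatticeTreeTypes                   -- ★ `dualLatt_dualLatt_latt`, `isIntMatrix_nonsing_inv_of_v_det_eq_one`, `mem_scaleLattice_stdLattice_iff`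
import Literature.NumberTheory.Automorphic.UnitaryLatticeTreeStabilizer              -- ★ `mapGL_latt_le_latt_iff`, `mapGL_latt_eq_latt_iff`
import Literature.NumberTheory.Automorphic.UnitaryLatticeTreeSelfDualFrames          -- ★ `scaleLattice_stdLattice_eq_latt_diagonal`
import Literature.NumberTheory.Automorphic.UnitaryLatticeTreeIsTree                  -- ★ `exists_scaleLattice_pow_stdLattice_le_of_isVertexLattice`
import HarnessLib

/-!
# Crux `H413`, line LH4 «(D-RAM) FOUR-FRAME» — the (ρ2b′-X) road, organ O-Glue, file 1∕2: PLANE GLUE DATA of a self-dual lattice and THE FIXED CRITERION IN PLANE LETTERS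

Cell `hodgecm-mathlib` (D-0151), FLOOR 0, crux item H413 = `stmt-HodgeConjecture-24833`, route of record `HCCMUnconditional`; squad F0∕P3c∕LH4; registered stub concerned:
`F0P3cDyRamFourFrameU2H.stub_U2H_fixedPointCensus_typeTwo_unit0` ((ρ2b′-X), U2H ED. 15 :418) through the payer lineage's HEAD-OF-ORGANS over ★ p857374 `…SignedCensusNV`.
THEOREMS ONLY (no `def`, no instance, no notation, no `sorry`); lane `--supports stmt-HodgeConjecture-24833 --as helper` (count-neutral).  DATUM-FREE (`K` valued, `𝒪[K]` a PID
where stated, `σ` an isometric involution, `|ϖ| = exp(−1)`, block form with `H₂` hermitian of unit determinant, `|h| = 1`; no `|2|`, no residue field).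

THE MATHEMATICS.  Block currency of ★ `UnitaryLatticeTreeTubeCoordinate`: `V = K³ = W ⊕ Ke₁`, `W = ker pr₁ = ι_W(K²)` (`ι_W y = (y₀, 0, y₁)`, ★ T2c `planeMatrix`),
`H = !![H₂ 0 0, 0, H₂ 0 1; 0, h, 0; H₂ 1 0, 0, H₂ 1 1]`, `Γ = endoGL (γ₂, u)` a block element.
§2 PLANE GLUE DATA (`b ≥ 1`): every self-dual `M` with tube coordinate `b ≥ 1` carries `(B₂, w₀, x₀)`: `B₂ = g·𝒪²` a plane lattice with `ι_W(B₂) = M ∩ W` (`B₂ := ι_W⁻¹(M ∩ W)`;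
sandwich `ϖ^j𝒪² ≤ B₂ ≤ B₂ + 𝒪w₀ ≤ B₂^♯ ≤ (ϖ^j𝒪²)^♯` + ★ PID sandwich), a generator `x₀ ∈ M` (`|x₀,₁|·|ϖ|^b = 1`, ★ (c1-i)) with `pr_W x₀ = ι_W w₀`, and the three binders of
★ p857377's cone index set ∕ ★ T2b, in `H₂`-currency: (G1) `B₂ = (B₂ + 𝒪w₀)^♯` (★ T2a `glueData_of_generator` + ★ T2c `glueCondition_map_planeMatrix_iff_dualLatt_sup_span_eq`), (gen)
`B₂^♯ = B₂ + 𝒪w₀` (double dual ★ `dualLatt_dualLatt_latt`), (norm) `|⟨w₀, w₀⟩|·|ϖ|^{2b} = 1` (★ `v_pairing_generator_proj`).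
§3 FIXED CRITERION IN PLANE LETTERS (`Γ` unitary, `|u| = 1`): `Γ·M = M ⟺ γ₂·B₂ = B₂ ∧ γ₂w₀ − u·w₀ ∈ B₂` (★ T2c `mapGL_endoGL_eq_iff_of_generator` read through ★ T2c §3; stable ⇒
fixed because `|det γ₂| = 1`: `det Γ = det γ₂ · u`, a unitary matrix has `|det| = 1`); §4 the depth clause does not depend on the (gen)-class representative; hence (L5) a fixed
member's plane part lies in the cone index set `S_b(γ₂, u)` and (L6) every member of a fibre over `S_b` is fixed — the gluing digit never enters the fixed criterion.
File 2∕2 (`Theorems/F0P3cDyRamBlockGlueCount.lean`) assembles the count.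
HONEST LABEL.  Count-neutral lattice bookkeeping; nothing printed is asserted; (ρ2b′-X) stays OPEN; `HC_CM` is proved only modulo the 7 printed citations (2 remaining named inputs:
hLiu418 = `stmt-HodgeConjecture-24832`, h413 = `stmt-HodgeConjecture-24833`) until rung 0 closes.

## References
* [BruhatTits1972] F. Bruhat, J. Tits, *Groupes réductifs sur un corps local I*, Publ. Math. IHÉS 41 (1972), §10 (lattice models of the rank-one building; tube layers).
* [Kottwitz1986BaseChangeUnits] R. E. Kottwitz, *Base change for unit elements of Hecke algebras*, Compositio Math. 60 (1986), §1 pp. 240–241 (orbital integrals of units as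
  fixed-lattice counts), §3 pp. 247–249 (reduction to Levi blocks).
* [Jacobowitz1962] R. Jacobowitz, *Hermitian forms over local fields*, Amer. J. Math. 84 (1962), §4 (dual lattices, gluing of modular components).
-/

set_option autoImplicit false

noncomputable section

namespace Summit.HodgeConjecture.HodgeConjecture.Cruxes.H413.F0P3cDyRamBlockGluePlane

open scoped Valued WithZero Matrix MatrixGroups
open Literature.NumberTheory.Automorphic Literature.NumberTheory.Automorphic.HermitianLattice Literature.NumberTheory.Automorphic.UnitaryLatticeTree
open Literature.NumberTheory.Rogawski1990

variable {K : Type*} [Field K] [Valued K ℤᵐ⁰]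


/-! ## §2 PLANE GLUE DATA of a self-dual lattice at tube coordinate `b ≥ 1` (T2-side) -/

/-- **PLANE GLUE DATA.**  A self-dual `M` (block form; `σ` isometric involution, `H₂` hermitian with unit determinant, `|h| = 1`, `σh = h`; `𝒪` a PID) with tube coordinate `b ≥ 1`
carries: a plane lattice `B₂ = g·𝒪²` with `ι_W(B₂) = M ∩ W`; a generator `x₀ ∈ M`, `|x₀,₁|·|ϖ|^b = 1`, with `pr_W x₀ = ι_W w₀`; and, in `H₂`-currency, (G1) `w ∈ B₂ ⟺ w ∈ B₂^♯ ∧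
|⟨w₀, w⟩| ≤ 1`, (gen) every `w ∈ B₂^♯` is `t·w₀ + a` (`|t| ≤ 1`, `a ∈ B₂`), (norm) `|⟨w₀, w₀⟩|·|ϖ|^{2b} = 1` — the `∃ w₀` binders of ★ p857377's index set and ★ T2b's
hypotheses, supplied by the lattice itself. [cite: Jacobowitz1962, §4] [cite: BruhatTits1972, §10] -/
theorem exists_planeGlueData [IsPrincipalIdealRing 𝒪[K]] (σ : K →+* K) (hσ : ∀ a, σ (σ a) = a) (hvσ : ∀ a, Valued.v (σ a) = Valued.v a)
    {ϖ : K} (hϖ : Valued.v ϖ = WithZero.exp (-1 : ℤ))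
    {H₂ : Matrix (Fin 2) (Fin 2) K} (hH₂ : IsUnit H₂.det) (hH₂σ : (H₂.map σ)ᵀ = H₂) {h : K} (hh : Valued.v h = 1)
    {M : Submodule 𝒪[K] (Fin 3 → K)} (hM : IsSelfDualLattice σ ϖ (!![H₂ 0 0, 0, H₂ 0 1; 0, h, 0; H₂ 1 0, 0, H₂ 1 1] : Matrix (Fin 3) (Fin 3) K) M)
    {b : ℕ} (hb1 : 1 ≤ b) (hb : ∀ c : K, (Pi.single 1 c : Fin 3 → K) ∈ M ↔ Valued.v c ≤ Valued.v ϖ ^ b) :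
    ∃ (B₂ : Submodule 𝒪[K] (Fin 2 → K)) (w₀ : Fin 2 → K) (x₀ : Fin 3 → K),
      (∃ g : GL (Fin 2) K, B₂ = latt (g : Matrix (Fin 2) (Fin 2) K)) ∧
      B₂.map ((Matrix.toLin' (!![1, 0; 0, 0; 0, 1] : Matrix (Fin 3) (Fin 2) K)).restrictScalars 𝒪[K]) =
        M ⊓ LinearMap.ker ((LinearMap.proj (1 : Fin 3) : (Fin 3 → K) →ₗ[K] K).restrictScalars 𝒪[K]) ∧
      x₀ ∈ M ∧ Valued.v (x₀ 1) * Valued.v ϖ ^ b = 1 ∧ x₀ - Pi.single 1 (x₀ 1) = ![w₀ 0, 0, w₀ 1] ∧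
      (∀ w, w ∈ B₂ ↔ (w ∈ dualLatt σ H₂ B₂ ∧ Valued.v (pairing σ H₂ w₀ w) ≤ 1)) ∧
      (∀ w ∈ dualLatt σ H₂ B₂, ∃ (t : K) (a : Fin 2 → K), Valued.v t ≤ 1 ∧ a ∈ B₂ ∧ w = t • w₀ + a) ∧
      Valued.v (pairing σ H₂ w₀ w₀) * Valued.v ϖ ^ (2 * b) = 1 := by
  classical
  set H : Matrix (Fin 3) (Fin 3) K := !![H₂ 0 0, 0, H₂ 0 1; 0, h, 0; H₂ 1 0, 0, H₂ 1 1] with hHdef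
  set Wk : Submodule 𝒪[K] (Fin 3 → K) := LinearMap.ker ((LinearMap.proj (1 : Fin 3) : (Fin 3 → K) →ₗ[K] K).restrictScalars 𝒪[K]) with hWk
  set ι := ((Matrix.toLin' (!![1, 0; 0, 0; 0, 1] : Matrix (Fin 3) (Fin 2) K)).restrictScalars 𝒪[K]) with hι
  -- bookkeeping
  have hϖv0 : Valued.v ϖ ≠ 0 := by rw [hϖ]; exact WithZero.coe_ne_zero
  have hϖ0 : ϖ ≠ 0 := fun h0 => hϖv0 (by rw [h0, map_zero])
  have hϖ1 : Valued.v ϖ ≤ 1 := by rw [hϖ, ← WithZero.exp_zero, WithZero.exp_le_exp]; norm_num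
  have hHrow : ∀ l : Fin 3, l ≠ 1 → H 1 l = 0 := fun l hl => endoShapeForm_row H₂ h l hl
  have hH₂h : ∀ a c : Fin 2, σ (H₂ a c) = H₂ c a := fun a c => by
    have e := congrFun (congrFun hH₂σ c) a
    rwa [Matrix.transpose_apply, Matrix.map_apply] at e
  have hsymm₂ : ∀ x y : Fin 2 → K, Valued.v (pairing σ H₂ y x) = Valued.v (pairing σ H₂ x y) := v_pairing_comm_of_hermitian hvσ hσ hH₂h
  have hιy : ∀ y : Fin 2 → K, ι y = ![y 0, 0, y 1] := fun y => by
    rw [hι, LinearMap.restrictScalars_apply, Matrix.toLin'_apply, planeMatrix_mulVec]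
  -- the slope bound and a generator of the tube coordinate `b`
  obtain ⟨b', hb', hpr', x₀, hx₀, hx₀1⟩ := exists_tubeCoordinate σ hvσ hϖ hH₂ hh hM
  obtain ⟨hbb, -⟩ := tubeCoordinate_unique hϖ hb hb'
  subst hbb
  -- the `W`-direction of the generator, read on the plane
  set w : Fin 3 → K := x₀ - Pi.single 1 (x₀ 1) with hw
  have hw1 : w 1 = 0 := by simp [hw]
  set w₂ : Fin 2 → K := ![w 0, w 2] with hw₂
  have hpr : x₀ - Pi.single 1 (x₀ 1) = ![w₂ 0, 0, w₂ 1] := by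
    rw [← hw, eq_plane_of_apply_one_eq_zero hw1]
    simp [hw₂]
  -- the plane lattice `B₂ = ι⁻¹(M ∩ W)`
  set B₂ : Submodule 𝒪[K] (Fin 2 → K) := (M ⊓ Wk).comap ι with hB₂
  have hmemB₂ : ∀ y : Fin 2 → K, y ∈ B₂ ↔ (![y 0, 0, y 1] : Fin 3 → K) ∈ M := fun y => by
    rw [hB₂, Submodule.mem_comap, hιy]
    exact ⟨fun hy => hy.1, fun hy => ⟨hy, (mem_kerProj_one_iff _).2 (by simp)⟩⟩
  have hBmap : B₂.map ι = M ⊓ Wk := by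
    rw [hB₂, Submodule.map_comap_eq, inf_eq_right]
    rintro z ⟨hzM, hzW⟩
    have hz1 := (mem_kerProj_one_iff z).1 hzW
    exact ⟨![z 0, z 2], by rw [hιy]; exact (eq_plane_of_apply_one_eq_zero hz1).symm⟩
  -- ★ T2a glue data: (G1) in `K³`, the generator decomposition
  obtain ⟨hG1, -, -⟩ := glueData_of_generator σ hvσ hϖ hH₂ hh hM hb1 hb hpr' hx₀ hx₀1
  -- (G1) on the plane: `(B₂ + 𝒪w₂)^♯ = B₂`
  have hd : dualLatt σ H₂ (B₂ ⊔ Submodule.span 𝒪[K] {w₂}) = B₂ :=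
    (glueCondition_map_planeMatrix_iff_dualLatt_sup_span_eq hvσ H₂ h B₂ hpr).1 (by rw [hBmap]; exact hG1)
  have hG1₂ : ∀ y, y ∈ B₂ ↔ (y ∈ dualLatt σ H₂ B₂ ∧ Valued.v (pairing σ H₂ w₂ y) ≤ 1) := fun y => by
    have e := (Submodule.ext_iff.1 hd y).symm
    rwa [mem_dualLatt_sup_span_iff hvσ, ← mem_dualLatt] at e
  -- the sandwich `ϖ^j 𝒪² ≤ B₂ ≤ B₂ + 𝒪w₂ ≤ B₂^♯ ≤ (ϖ^j 𝒪²)^♯`: every term is a lattice `g·𝒪²`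
  obtain ⟨j, hj⟩ := exists_scaleLattice_pow_stdLattice_le_of_isVertexLattice hϖ hM
  have hjdet : (Matrix.diagonal fun _ : Fin 2 => ϖ ^ j).det ≠ 0 := by
    rw [Matrix.det_diagonal, Finset.prod_const]; exact pow_ne_zero _ (pow_ne_zero _ hϖ0)
  set a : GL (Fin 2) K := Matrix.GeneralLinearGroup.mkOfDetNeZero _ hjdet with ha
  have hlo : latt (a : Matrix (Fin 2) (Fin 2) K) ≤ B₂ := by
    intro y hy
    rw [ha, Matrix.GeneralLinearGroup.val_mkOfDetNeZero, ← scaleLattice_stdLattice_eq_latt_diagonal (pow_ne_zero _ hϖ0),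
      mem_scaleLattice_stdLattice_iff (pow_ne_zero _ hϖ0)] at hy
    rw [hmemB₂]
    refine hj ((mem_scaleLattice_stdLattice_iff (pow_ne_zero _ hϖ0) _).2 fun i => ?_)
    fin_cases i
    · simpa using hy 0
    · simp
    · simpa using hy 1
  have hsup_le_dual : B₂ ⊔ Submodule.span 𝒪[K] {w₂} ≤ dualLatt σ H₂ B₂ :=
    le_dualLatt_comm hsymm₂ (le_of_eq hd.symm)
  have hdual_le : dualLatt σ H₂ B₂ ≤ dualLatt σ H₂ (latt (a : Matrix (Fin 2) (Fin 2) K)) := dualLatt_antitone σ H₂ hlo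
  rw [dualLatt_latt σ hvσ hH₂ a] at hdual_le
  have hGdet : IsUnit (formCongr σ a H₂).det := by
    change IsUnit (((a : Matrix (Fin 2) (Fin 2) K).map σ)ᵀ * H₂ * (a : Matrix (Fin 2) (Fin 2) K)).det
    rw [Matrix.det_mul, Matrix.det_mul]
    exact ((isUnit_det_transpose_map σ (Matrix.isUnits_det_units a)).mul hH₂).mul (Matrix.isUnits_det_units a)
  have hcdet : ((a : Matrix (Fin 2) (Fin 2) K) * (formCongr σ a H₂)⁻¹).det ≠ 0 := by
    rw [Matrix.det_mul]
    refine mul_ne_zero (Matrix.isUnits_det_units a).ne_zero ?_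
    rw [Matrix.det_nonsing_inv, Ring.inverse_eq_inv']
    exact inv_ne_zero hGdet.ne_zero
  set c : GL (Fin 2) K := Matrix.GeneralLinearGroup.mkOfDetNeZero _ hcdet with hc
  have hcoe : (c : Matrix (Fin 2) (Fin 2) K) = (a : Matrix (Fin 2) (Fin 2) K) * (formCongr σ a H₂)⁻¹ := by
    rw [hc, Matrix.GeneralLinearGroup.val_mkOfDetNeZero]
  obtain ⟨g, hg⟩ := exists_eq_latt_of_latt_le_of_le_latt a c B₂ hlo ((le_sup_left.trans hsup_le_dual).trans (by rw [hcoe]; exact hdual_le))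
  obtain ⟨g', hg'⟩ := exists_eq_latt_of_latt_le_of_le_latt a c (B₂ ⊔ Submodule.span 𝒪[K] {w₂}) (hlo.trans le_sup_left)
    (hsup_le_dual.trans (by rw [hcoe]; exact hdual_le))
  -- (gen): `B₂^♯ = (B₂ + 𝒪w₂)^♯♯ = B₂ + 𝒪w₂`
  have hdd : dualLatt σ H₂ B₂ = B₂ ⊔ Submodule.span 𝒪[K] {w₂} := by
    conv_lhs => rw [← hd]
    rw [hg', dualLatt_dualLatt_latt σ hσ hvσ hH₂ hH₂σ (Matrix.isUnits_det_units g')]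
  have hgen : ∀ y ∈ dualLatt σ H₂ B₂, ∃ (t : K) (a' : Fin 2 → K), Valued.v t ≤ 1 ∧ a' ∈ B₂ ∧ y = t • w₂ + a' := by
    intro y hy
    rw [hdd, mem_sup_span_singleton_iff] at hy
    obtain ⟨t, ht, hyt⟩ := hy
    exact ⟨t, y - t • w₂, ht, hyt, by abel⟩
  -- (norm): `|⟨w₂, w₂⟩| = |⟨x₀, pr_W x₀⟩| = |ϖ|^{−2b}`
  have hnorm : Valued.v (pairing σ H₂ w₂ w₂) * Valued.v ϖ ^ (2 * b) = 1 := by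
    rw [← pairing_endoShapeForm_plane σ H₂ h, ← hpr, pairing_sub_single_left_of_block σ H 1 hHrow x₀ hw1,
      v_pairing_generator_proj σ hvσ hϖ hh hM hb1 hx₀ hx₀1, two_mul, pow_add]
    have hb0 : Valued.v ϖ ^ b ≠ 0 := pow_ne_zero _ hϖv0
    field_simp
  exact ⟨B₂, w₂, x₀, ⟨g, hg⟩, hBmap, hx₀, hx₀1, hpr, hG1₂, hgen, hnorm⟩

/-! ## §3 The fixed criterion in plane letters; §4 independence of the representative -/

/-- **THE DEPTH CLAUSE DOES NOT DEPEND ON THE REPRESENTATIVE**: if `w₀' = t·w₀ + a` and `w₀ = t'·w₀' + a'` (`|t|, |t'| ≤ 1`, `a, a' ∈ B₂`) — two (gen)-related representatives —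
and `B₂` is `γ₂`-stable, `|u| ≤ 1`, then `γ₂w₀ − u·w₀ ∈ B₂ ⟺ γ₂w₀' − u·w₀' ∈ B₂`. [cite: Jacobowitz1962, §4] -/
theorem sub_smul_mem_iff_of_related {B₂ : Submodule 𝒪[K] (Fin 2 → K)} {γ₂ : Matrix (Fin 2) (Fin 2) K} (hst : ∀ y ∈ B₂, γ₂ *ᵥ y ∈ B₂)
    {u : K} (hu : Valued.v u ≤ 1) {w₀ w₀' : Fin 2 → K}
    (h₁ : ∃ (t : K) (a : Fin 2 → K), Valued.v t ≤ 1 ∧ a ∈ B₂ ∧ w₀' = t • w₀ + a)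
    (h₂ : ∃ (t : K) (a : Fin 2 → K), Valued.v t ≤ 1 ∧ a ∈ B₂ ∧ w₀ = t • w₀' + a) :
    γ₂ *ᵥ w₀ - u • w₀ ∈ B₂ ↔ γ₂ *ᵥ w₀' - u • w₀' ∈ B₂ := by
  -- one direction suffices by symmetry
  have aux : ∀ {w w' : Fin 2 → K}, (∃ (t : K) (a : Fin 2 → K), Valued.v t ≤ 1 ∧ a ∈ B₂ ∧ w' = t • w + a) →
      γ₂ *ᵥ w - u • w ∈ B₂ → γ₂ *ᵥ w' - u • w' ∈ B₂ := by
    rintro w w' ⟨t, a, ht, ha, rfl⟩ hw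
    have e : γ₂ *ᵥ (t • w + a) - u • (t • w + a) = t • (γ₂ *ᵥ w - u • w) + (γ₂ *ᵥ a - u • a) := by
      rw [Matrix.mulVec_add, Matrix.mulVec_smul, smul_add, smul_sub, smul_comm u t w]; abel
    rw [e]
    refine B₂.add_mem ?_ (B₂.sub_mem (hst a ha) ?_)
    · exact B₂.smul_mem (⟨t, (Valuation.mem_integer_iff _ _).2 ht⟩ : 𝒪[K]) hw
    · exact B₂.smul_mem (⟨u, (Valuation.mem_integer_iff _ _).2 hu⟩ : 𝒪[K]) ha
  exact ⟨aux h₁, aux h₂⟩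

/-- A unitary matrix has a determinant of absolute value `1` (`σ` valuation-preserving, the form non-degenerate): `σ(det t)·det J·det t = det J`.
[cite: Jacobowitz1962, §4] -/
theorem v_det_coe_eq_one_of_mem_unitaryGroupOfForm {N : ℕ} {σ : K →+* K} (hvσ : ∀ a, Valued.v (σ a) = Valued.v a) {J : Matrix (Fin N) (Fin N) K}
    (hJ : J.det ≠ 0) {t : GL (Fin N) K} (ht : t ∈ unitaryGroupOfForm σ J) : Valued.v (t : Matrix (Fin N) (Fin N) K).det = 1 := by
  have h := congrArg Matrix.det (show ((t : Matrix (Fin N) (Fin N) K).map σ)ᵀ * J * (t : Matrix (Fin N) (Fin N) K) = J from ht)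
  rw [Matrix.det_mul, Matrix.det_mul, Matrix.det_transpose] at h
  have hmap : ((t : Matrix (Fin N) (Fin N) K).map σ).det = σ (t : Matrix (Fin N) (Fin N) K).det := by
    rw [← RingHom.mapMatrix_apply, ← RingHom.map_det]
  rw [hmap] at h
  have h1 : σ (t : Matrix (Fin N) (Fin N) K).det * (t : Matrix (Fin N) (Fin N) K).det = 1 := by
    refine mul_right_cancel₀ hJ ?_
    rw [one_mul]
    calc σ (t : Matrix (Fin N) (Fin N) K).det * (t : Matrix (Fin N) (Fin N) K).det * J.det
        = σ (t : Matrix (Fin N) (Fin N) K).det * J.det * (t : Matrix (Fin N) (Fin N) K).det := by ring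
      _ = J.det := h
  have hv : Valued.v (t : Matrix (Fin N) (Fin N) K).det * Valued.v (t : Matrix (Fin N) (Fin N) K).det = 1 := by
    have := congrArg Valued.v h1
    rwa [map_mul, map_one, hvσ] at this
  rcases le_total (Valued.v (t : Matrix (Fin N) (Fin N) K).det) 1 with hle | hge
  · refine le_antisymm hle ?_
    calc (1 : ℤᵐ⁰) = Valued.v (t : Matrix (Fin N) (Fin N) K).det * Valued.v (t : Matrix (Fin N) (Fin N) K).det := hv.symm
      _ ≤ Valued.v (t : Matrix (Fin N) (Fin N) K).det * 1 := by gcongr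
      _ = _ := mul_one _
  · refine le_antisymm ?_ hge
    calc Valued.v (t : Matrix (Fin N) (Fin N) K).det = Valued.v (t : Matrix (Fin N) (Fin N) K).det * 1 := (mul_one _).symm
      _ ≤ Valued.v (t : Matrix (Fin N) (Fin N) K).det * Valued.v (t : Matrix (Fin N) (Fin N) K).det := by gcongr
      _ = 1 := hv

/-- **STABLE ⟹ FIXED for a lattice under a volume-preserving map**: if `B = g·𝒪^N` and `|det γ| = 1`, then `γ·B = B ⟺ γ·B ⊆ B` (pointwise) — an integral matrix of unit
determinant has an integral inverse (★ `isIntMatrix_nonsing_inv_of_v_det_eq_one`, ★ `mapGL_latt_le_latt_iff`, ★ `mapGL_latt_eq_latt_iff`). [cite: BruhatTits1972, §10] -/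
theorem mapGL_eq_iff_forall_mulVec_mem_of_v_det_eq_one {N : ℕ} {γ : GL (Fin N) K} (hdet : Valued.v (γ : Matrix (Fin N) (Fin N) K).det = 1)
    {B : Submodule 𝒪[K] (Fin N → K)} (hg : ∃ g : GL (Fin N) K, B = latt (g : Matrix (Fin N) (Fin N) K)) :
    mapGL γ B = B ↔ ∀ y ∈ B, (γ : Matrix (Fin N) (Fin N) K) *ᵥ y ∈ B := by
  constructor
  · intro h y hy
    have hy' : (γ : Matrix (Fin N) (Fin N) K) *ᵥ y ∈ mapGL γ B :=
      Submodule.mem_map.2 ⟨y, hy, by rw [LinearMap.restrictScalars_apply, Matrix.toLin'_apply]⟩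
    rwa [h] at hy'
  · intro hst
    obtain ⟨g, rfl⟩ := hg
    have hle : mapGL γ (latt (g : Matrix (Fin N) (Fin N) K)) ≤ latt (g : Matrix (Fin N) (Fin N) K) := by
      intro z hz
      obtain ⟨y, hy, rfl⟩ := Submodule.mem_map.1 hz
      rw [LinearMap.restrictScalars_apply, Matrix.toLin'_apply]
      exact hst y hy
    have hint := (mapGL_latt_le_latt_iff γ g g).1 hle
    have hdet' : Valued.v (((g⁻¹ * γ * g : GL (Fin N) K) : Matrix (Fin N) (Fin N) K)).det = 1 := by
      rw [Units.val_mul, Units.val_mul, Matrix.det_units_conj', hdet]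
    have hinv := isIntMatrix_nonsing_inv_of_v_det_eq_one hint hdet'
    refine (mapGL_latt_eq_latt_iff γ g).2 ⟨hint, ?_⟩
    have e : ((g⁻¹ * γ⁻¹ * g : GL (Fin N) K) : Matrix (Fin N) (Fin N) K) = (((g⁻¹ * γ * g : GL (Fin N) K) : Matrix (Fin N) (Fin N) K))⁻¹ := by
      rw [← Matrix.coe_units_inv, mul_inv_rev, mul_inv_rev, inv_inv, mul_assoc]
    rw [e]
    exact hinv

/-- **FIXED CRITERION IN PLANE LETTERS.**  For a self-dual `M` with plane glue data `(B₂, w₀, x₀)` at tube coordinate `b ≥ 1` (§2) and a UNITARY block element `Γ = endoGL (γ₂, u)`: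
`Γ·M = M ⟺ γ₂·B₂ = B₂ ∧ γ₂w₀ − u·w₀ ∈ B₂` (★ T2c `mapGL_endoGL_eq_iff_of_generator` read through ★ T2c §3 `forall_endoGL_mulVec_mem_map_planeMatrix_iff` ∕
`endoGL_mulVec_plane_sub_smul_mem_map_planeMatrix_iff`; `γ₂B₂ ⊆ B₂ ⇒ γ₂B₂ = B₂` because `|det γ₂| = 1`). [cite: Kottwitz1986BaseChangeUnits, §1 pp. 240–241, §3 pp. 247–249] [cite: BruhatTits1972, §10] -/
theorem mapGL_endoGL_eq_iff_plane (σ : K →+* K) (hvσ : ∀ a, Valued.v (σ a) = Valued.v a) {ϖ : K} (hϖ : Valued.v ϖ = WithZero.exp (-1 : ℤ))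
    {H₂ : Matrix (Fin 2) (Fin 2) K} (hH₂ : IsUnit H₂.det) {h : K} (hh : Valued.v h = 1)
    {M : Submodule 𝒪[K] (Fin 3 → K)} (hM : IsSelfDualLattice σ ϖ (!![H₂ 0 0, 0, H₂ 0 1; 0, h, 0; H₂ 1 0, 0, H₂ 1 1] : Matrix (Fin 3) (Fin 3) K) M)
    {b : ℕ} (hb1 : 1 ≤ b) (hb : ∀ c : K, (Pi.single 1 c : Fin 3 → K) ∈ M ↔ Valued.v c ≤ Valued.v ϖ ^ b)
    {B₂ : Submodule 𝒪[K] (Fin 2 → K)} {w₀ : Fin 2 → K} {x₀ : Fin 3 → K} (hg : ∃ g : GL (Fin 2) K, B₂ = latt (g : Matrix (Fin 2) (Fin 2) K))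
    (hB : B₂.map ((Matrix.toLin' (!![1, 0; 0, 0; 0, 1] : Matrix (Fin 3) (Fin 2) K)).restrictScalars 𝒪[K]) =
      M ⊓ LinearMap.ker ((LinearMap.proj (1 : Fin 3) : (Fin 3 → K) →ₗ[K] K).restrictScalars 𝒪[K]))
    (hx₀ : x₀ ∈ M) (hx₀1 : Valued.v (x₀ 1) * Valued.v ϖ ^ b = 1) (hpr : x₀ - Pi.single 1 (x₀ 1) = ![w₀ 0, 0, w₀ 1])
    (γ₂ : GL (Fin 2) K) (u : GL (Fin 1) K) (hΓ : endoGL (γ₂, u) ∈ unitaryGroupOfForm σ (!![H₂ 0 0, 0, H₂ 0 1; 0, h, 0; H₂ 1 0, 0, H₂ 1 1] : Matrix (Fin 3) (Fin 3) K))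
    (hu : Valued.v ((u : Matrix (Fin 1) (Fin 1) K) 0 0) = 1) :
    mapGL (endoGL (γ₂, u)) M = M ↔
      mapGL γ₂ B₂ = B₂ ∧ (γ₂ : Matrix (Fin 2) (Fin 2) K) *ᵥ w₀ - (u : Matrix (Fin 1) (Fin 1) K) 0 0 • w₀ ∈ B₂ := by
  -- the slope bound of the tube coordinate `b`
  obtain ⟨b', hb', hpr', -⟩ := exists_tubeCoordinate σ hvσ hϖ hH₂ hh hM
  obtain ⟨hbb', -⟩ := tubeCoordinate_unique hϖ hb hb'
  subst hbb'
  -- `|det γ₂| = 1` from the unitarity of `Γ` (`det Γ = det γ₂ · u`, `|u| = 1`)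
  have hdetΓ := v_det_coe_eq_one_of_mem_unitaryGroupOfForm hvσ (isUnit_det_endoShapeForm hH₂ hh).ne_zero hΓ
  rw [coe_endoGL_eq_endoShape, det_endoShape, map_mul, hu, mul_one] at hdetΓ
  -- ★ T2c's criterion, read on the plane
  rw [mapGL_endoGL_eq_iff_of_generator σ hvσ hϖ hH₂ hh hM hb1 hb hpr' hx₀ hx₀1 γ₂ u hΓ hu.le, ← hB, hpr,
    forall_endoGL_mulVec_mem_map_planeMatrix_iff, endoGL_mulVec_plane_sub_smul_mem_map_planeMatrix_iff,
    mapGL_eq_iff_forall_mulVec_mem_of_v_det_eq_one hdetΓ hg]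

/-- The plane embedding `ι_W` is injective. [cite: BruhatTits1972, §10] -/
theorem planeMatrix_injective : Function.Injective ((Matrix.toLin' (!![1, 0; 0, 0; 0, 1] : Matrix (Fin 3) (Fin 2) K)).restrictScalars 𝒪[K]) := by
  intro y y' hyy
  rw [LinearMap.restrictScalars_apply, LinearMap.restrictScalars_apply, Matrix.toLin'_apply, Matrix.toLin'_apply, planeMatrix_mulVec,
    planeMatrix_mulVec] at hyy
  ext i
  fin_cases i
  · simpa using congrFun hyy 0
  · simpa using congrFun hyy 2

/-- The `W`-part of any lattice is an embedded plane lattice: `ι_W(ι_W⁻¹(M ∩ W)) = M ∩ W`. [cite: BruhatTits1972, §10] -/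
theorem map_comap_planeMatrix_inf_ker (M : Submodule 𝒪[K] (Fin 3 → K)) :
    ((M ⊓ LinearMap.ker ((LinearMap.proj (1 : Fin 3) : (Fin 3 → K) →ₗ[K] K).restrictScalars 𝒪[K])).comap
        ((Matrix.toLin' (!![1, 0; 0, 0; 0, 1] : Matrix (Fin 3) (Fin 2) K)).restrictScalars 𝒪[K])).map
      ((Matrix.toLin' (!![1, 0; 0, 0; 0, 1] : Matrix (Fin 3) (Fin 2) K)).restrictScalars 𝒪[K]) =
      M ⊓ LinearMap.ker ((LinearMap.proj (1 : Fin 3) : (Fin 3 → K) →ₗ[K] K).restrictScalars 𝒪[K]) := by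
  rw [Submodule.map_comap_eq, inf_eq_right]
  rintro z ⟨-, hzW⟩
  have hz1 := (mem_kerProj_one_iff z).1 hzW
  exact ⟨![z 0, z 2], by rw [LinearMap.restrictScalars_apply, Matrix.toLin'_apply, planeMatrix_mulVec]; exact (eq_plane_of_apply_one_eq_zero hz1).symm⟩

/-- **A FIXED MEMBER'S PLANE PART LIES IN THE CONE INDEX SET.**  If `M` is self-dual with tube coordinate `b ≥ 1` and `Γ·M = M` (`Γ = endoGL (γ₂, u)` unitary, `|u| = 1`), then
`ι_W⁻¹(M ∩ W)` belongs to `S_b(γ₂, u)` (§2 data + §3). [cite: Kottwitz1986BaseChangeUnits, §1 pp. 240–241] [cite: BruhatTits1972, §10] [cite: Jacobowitz1962, §4] -/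
theorem comap_planeMatrix_mem_coneIndex_of_mapGL_eq [IsPrincipalIdealRing 𝒪[K]] (σ : K →+* K) (hσ : ∀ a, σ (σ a) = a)
    (hvσ : ∀ a, Valued.v (σ a) = Valued.v a) {ϖ : K} (hϖ : Valued.v ϖ = WithZero.exp (-1 : ℤ))
    {H₂ : Matrix (Fin 2) (Fin 2) K} (hH₂ : IsUnit H₂.det) (hH₂σ : (H₂.map σ)ᵀ = H₂) {h : K} (hh : Valued.v h = 1)
    {M : Submodule 𝒪[K] (Fin 3 → K)} (hM : IsSelfDualLattice σ ϖ (!![H₂ 0 0, 0, H₂ 0 1; 0, h, 0; H₂ 1 0, 0, H₂ 1 1] : Matrix (Fin 3) (Fin 3) K) M)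
    {b : ℕ} (hb1 : 1 ≤ b) (hb : ∀ c : K, (Pi.single 1 c : Fin 3 → K) ∈ M ↔ Valued.v c ≤ Valued.v ϖ ^ b)
    (γ₂ : GL (Fin 2) K) (u : GL (Fin 1) K) (hΓ : endoGL (γ₂, u) ∈ unitaryGroupOfForm σ (!![H₂ 0 0, 0, H₂ 0 1; 0, h, 0; H₂ 1 0, 0, H₂ 1 1] : Matrix (Fin 3) (Fin 3) K))
    (hu : Valued.v ((u : Matrix (Fin 1) (Fin 1) K) 0 0) = 1) (hfix : mapGL (endoGL (γ₂, u)) M = M) :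
    (M ⊓ LinearMap.ker ((LinearMap.proj (1 : Fin 3) : (Fin 3 → K) →ₗ[K] K).restrictScalars 𝒪[K])).comap
        ((Matrix.toLin' (!![1, 0; 0, 0; 0, 1] : Matrix (Fin 3) (Fin 2) K)).restrictScalars 𝒪[K]) ∈
      {B : Submodule 𝒪[K] (Fin 2 → K) | (∃ g : GL (Fin 2) K, B = latt (g : Matrix (Fin 2) (Fin 2) K)) ∧ mapGL γ₂ B = B ∧
          ∃ w₀ : Fin 2 → K, (∀ w, w ∈ B ↔ (w ∈ dualLatt σ H₂ B ∧ Valued.v (pairing σ H₂ w₀ w) ≤ 1)) ∧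
            (∀ w ∈ dualLatt σ H₂ B, ∃ (t : K) (a : Fin 2 → K), Valued.v t ≤ 1 ∧ a ∈ B ∧ w = t • w₀ + a) ∧
            Valued.v (pairing σ H₂ w₀ w₀) * Valued.v ϖ ^ (2 * b) = 1 ∧
            (γ₂ : Matrix (Fin 2) (Fin 2) K).mulVec w₀ - (u : Matrix (Fin 1) (Fin 1) K) 0 0 • w₀ ∈ B} := by
  obtain ⟨B₂, w₀, x₀, hg, hB, hx₀, hx₀1, hpr, hG1, hgen, hnorm⟩ := exists_planeGlueData σ hσ hvσ hϖ hH₂ hH₂σ hh hM hb1 hb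
  have hcomap : (M ⊓ LinearMap.ker ((LinearMap.proj (1 : Fin 3) : (Fin 3 → K) →ₗ[K] K).restrictScalars 𝒪[K])).comap
      ((Matrix.toLin' (!![1, 0; 0, 0; 0, 1] : Matrix (Fin 3) (Fin 2) K)).restrictScalars 𝒪[K]) = B₂ := by
    rw [← hB, Submodule.comap_map_eq_of_injective planeMatrix_injective]
  obtain ⟨hγB, hdepth⟩ := (mapGL_endoGL_eq_iff_plane σ hvσ hϖ hH₂ hh hM hb1 hb hg hB hx₀ hx₀1 hpr γ₂ u hΓ hu).1 hfix
  rw [hcomap]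
  exact ⟨hg, hγB, w₀, hG1, hgen, hnorm, hdepth⟩

/-- **EVERY MEMBER OF A FIBRE OVER THE CONE INDEX SET IS FIXED** (the gluing digit never enters the fixed criterion): if `M` is self-dual with tube coordinate `b ≥ 1` and
`ι_W⁻¹(M ∩ W) ∈ S_b(γ₂, u)`, then `Γ·M = M` (§2 data; §4 moves the depth clause to `M`'s own representative; §3). [cite: Kottwitz1986BaseChangeUnits, §1 pp. 240–241, §3 pp. 247–249] [cite: BruhatTits1972, §10] -/
theorem mapGL_eq_of_comap_planeMatrix_mem_coneIndex [IsPrincipalIdealRing 𝒪[K]] (σ : K →+* K) (hσ : ∀ a, σ (σ a) = a)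
    (hvσ : ∀ a, Valued.v (σ a) = Valued.v a) {ϖ : K} (hϖ : Valued.v ϖ = WithZero.exp (-1 : ℤ))
    {H₂ : Matrix (Fin 2) (Fin 2) K} (hH₂ : IsUnit H₂.det) (hH₂σ : (H₂.map σ)ᵀ = H₂) {h : K} (hh : Valued.v h = 1)
    {M : Submodule 𝒪[K] (Fin 3 → K)} (hM : IsSelfDualLattice σ ϖ (!![H₂ 0 0, 0, H₂ 0 1; 0, h, 0; H₂ 1 0, 0, H₂ 1 1] : Matrix (Fin 3) (Fin 3) K) M)
    {b : ℕ} (hb1 : 1 ≤ b) (hb : ∀ c : K, (Pi.single 1 c : Fin 3 → K) ∈ M ↔ Valued.v c ≤ Valued.v ϖ ^ b)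
    (γ₂ : GL (Fin 2) K) (u : GL (Fin 1) K) (hΓ : endoGL (γ₂, u) ∈ unitaryGroupOfForm σ (!![H₂ 0 0, 0, H₂ 0 1; 0, h, 0; H₂ 1 0, 0, H₂ 1 1] : Matrix (Fin 3) (Fin 3) K))
    (hu : Valued.v ((u : Matrix (Fin 1) (Fin 1) K) 0 0) = 1)
    (hS : (M ⊓ LinearMap.ker ((LinearMap.proj (1 : Fin 3) : (Fin 3 → K) →ₗ[K] K).restrictScalars 𝒪[K])).comap
        ((Matrix.toLin' (!![1, 0; 0, 0; 0, 1] : Matrix (Fin 3) (Fin 2) K)).restrictScalars 𝒪[K]) ∈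
      {B : Submodule 𝒪[K] (Fin 2 → K) | (∃ g : GL (Fin 2) K, B = latt (g : Matrix (Fin 2) (Fin 2) K)) ∧ mapGL γ₂ B = B ∧
          ∃ w₀ : Fin 2 → K, (∀ w, w ∈ B ↔ (w ∈ dualLatt σ H₂ B ∧ Valued.v (pairing σ H₂ w₀ w) ≤ 1)) ∧
            (∀ w ∈ dualLatt σ H₂ B, ∃ (t : K) (a : Fin 2 → K), Valued.v t ≤ 1 ∧ a ∈ B ∧ w = t • w₀ + a) ∧
            Valued.v (pairing σ H₂ w₀ w₀) * Valued.v ϖ ^ (2 * b) = 1 ∧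
            (γ₂ : Matrix (Fin 2) (Fin 2) K).mulVec w₀ - (u : Matrix (Fin 1) (Fin 1) K) 0 0 • w₀ ∈ B}) :
    mapGL (endoGL (γ₂, u)) M = M := by
  obtain ⟨B₂, w₀', x₀, hg, hB, hx₀, hx₀1, hpr, hG1', hgen', -⟩ := exists_planeGlueData σ hσ hvσ hϖ hH₂ hH₂σ hh hM hb1 hb
  have hcomap : (M ⊓ LinearMap.ker ((LinearMap.proj (1 : Fin 3) : (Fin 3 → K) →ₗ[K] K).restrictScalars 𝒪[K])).comap
      ((Matrix.toLin' (!![1, 0; 0, 0; 0, 1] : Matrix (Fin 3) (Fin 2) K)).restrictScalars 𝒪[K]) = B₂ := by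
    rw [← hB, Submodule.comap_map_eq_of_injective planeMatrix_injective]
  rw [hcomap] at hS
  obtain ⟨-, hγB, w₀, hG1, hgen, -, hdepth⟩ := hS
  -- the two representatives are (gen)-related both ways
  have hH₂h : ∀ a c : Fin 2, σ (H₂ a c) = H₂ c a := fun a c => by
    have e := congrFun (congrFun hH₂σ c) a
    rwa [Matrix.transpose_apply, Matrix.map_apply] at e
  have hsymm₂ : ∀ x y : Fin 2 → K, Valued.v (pairing σ H₂ y x) = Valued.v (pairing σ H₂ x y) := v_pairing_comm_of_hermitian hvσ hσ hH₂h
  have hw₀'d : w₀' ∈ dualLatt σ H₂ B₂ := fun y hy => by rw [hsymm₂]; exact ((hG1' y).1 hy).2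
  have hw₀d : w₀ ∈ dualLatt σ H₂ B₂ := fun y hy => by rw [hsymm₂]; exact ((hG1 y).1 hy).2
  have hst : ∀ y ∈ B₂, (γ₂ : Matrix (Fin 2) (Fin 2) K) *ᵥ y ∈ B₂ := fun y hy => by
    have hy' : (γ₂ : Matrix (Fin 2) (Fin 2) K) *ᵥ y ∈ mapGL γ₂ B₂ :=
      Submodule.mem_map.2 ⟨y, hy, by rw [LinearMap.restrictScalars_apply, Matrix.toLin'_apply]⟩
    rwa [hγB] at hy'
  have hdepth' := (sub_smul_mem_iff_of_related hst hu.le (hgen _ hw₀'d) (hgen' _ hw₀d)).1 hdepth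
  exact (mapGL_endoGL_eq_iff_plane σ hvσ hϖ hH₂ hh hM hb1 hb hg hB hx₀ hx₀1 hpr γ₂ u hΓ hu).2 ⟨hγB, hdepth'⟩

end Summit.HodgeConjecture.HodgeConjecture.Cruxes.H413.F0P3cDyRamBlockGluePlane

end
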